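import Summits.AtomisticToContinuum.HydrodynamicLimit.Theorems.CollisionIsometryCLTAdaptedWeightCLTTLColumnDepolarisationBounds
import Summits.AtomisticToContinuum.HydrodynamicLimit.Theorems.CollisionIsometryCLTAdaptedWeightCLTTLColumnDepolarisationBalance

/-!
# Column depolarisation, part D: the FLOOR of the balance and the rank-3 half, from incoherent
# participation (pathwise)
(helpers for the registered stub `stub_columnDepolarisation` of the line `contact-source-duhamel`,
crux `CollisionIsometryCLT.AdaptedWeightCLT`, stmt-AtomisticToContinuum-14868; `--supports`,
anchor `cd3x_le_carrPartF`)

Two pathwise consequences of the piece representation (part A1, `…Pieces`) for the functionals of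
the balance (part B, `…Balance`), both exact algebra for every `σ`:
* `normSqT_dropT_le`: at every fold step the realised decrement `X_s` of a rank-2 cloud satisfies
  `‖X_s‖² ≤ ½ (tr S_s)²`, `S_s` the pair tensor: `X_s` is the sum over the pieces of their BRACKETS
  (power minus the powers of the two children, `dropT_eq_sum_brackets`); on the reflected pair a
  piece `m` has bracket `m⊗m − Qm⊗Qm − Pm⊗Pm = Qm⊗Pm + Pm⊗Qm` of norm `√2 |Qm||Pm| ≤ |m|²/√2`
  (`two_mul_normSqT_bracket_le`), pieces elsewhere have bracket `0`, and the energies of the pieces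
  on the pair add up to `tr S_s` (`sum_pairWeight`); hence `quadF ≤ ½ pairPartF`
  (`quadF_le_half_pairPartF`): the second-order floor of the depolarisation balance is dominated by
  the collision-integrated pair participation;
* `cd3x_le_carrPartF`: `‖cloud₃(k,u)‖² ≤ |u|² Σ_w |piece_w|⁴ ≤ |u|² Σ_i (tr T_i)²` (Cauchy–Schwarz, then
  grouping the pieces by carrier), so `cd3x ≤ 3 · carrPartF` — the rank-3 half of `CDAlongAt` follows
  PATHWISE from incoherent diffuseness (`IncoherentDiffuseAt`), no normal statistics needed;
and the signs `0 ≤ anisF, carrPartF, pairPartF`, whence `cd2 + cd3x ≤ anisF + 3·carrPartF` at the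
window's step count (`cd2_add_cd3x_le`). No definition and no `Prop` is introduced.

Proof route for the corrected stub `DiffuseAt → IncoherentDiffuseAt → ManyCollisionsAt →
OneStepNondegenerateAt → CDAlongAt` (file `…TLStubColumnDepolarisation`): fix `t, K`, `c₀` from OSN;
on `{≥ K(N+1) steps in the second half}` the balance `anisF_telescope` on the last `K(N+1)` steps and
OSN (`j = K(N+1)`) force a step `s*` there with `anisF s* ≤ (6 + 2·osnErr + ½P)/(2c₀K)`,
`P = pairPartF(second half)`; the balance on `[s*, m)`, OSN (`j = m − s*`) and
`quadF_le_half_pairPartF` give `cd2 = anisF m ≤ 3/(c₀K) + (c₀⁻¹+2)·osnErr + (c₀⁻¹+1)·P`; with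
`cd3x ≤ 3 carrPartF` and `cd2 + cd3x ≤ 84` off the good event, integrate and let `N → ∞`, `K → ∞`.
-/

namespace Summit.AtomisticToContinuum.HydrodynamicLimit.Theorems.ContactSourceDuhamel.TimeLocal
namespace ColumnDepolarisation

open scoped BigOperators Topology Classical MeasureTheory ENNReal InnerProductSpace
open Filter Set MeasureTheory
open Literature.Analysis.FluidPDE
open Literature.MathematicalPhysics.KineticTheory (hsDiameter)
open Duhamel

noncomputable section

variable {σ : ℝ} {N : ℕ} {y : Cfg N} {r : ℕ}

/-! ## Traces -/

/-- `trT` is additive over finite sums. -/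
theorem trT_sum {ι : Type*} (s : Finset ι) (T : ι → Tens 2) :
    trT (∑ w ∈ s, T w) = ∑ w ∈ s, trT (T w) := by
  simp only [trT, Finset.sum_apply]
  rw [Finset.sum_comm]

/-- The trace of the cloud family at a carrier is the energy of the pieces sitting there
(`tr (m ⊗ m) = ‖m‖²` piece by piece). -/
theorem trT_cfam (k : Fin (N + 1)) (a : V3) (s : ℕ) (i : Fin (N + 1)) :
    trT (cfam σ N y k a s i) =
      ∑ w ∈ Finset.univ.filter (fun w : Fin s → Bool => pieceCar σ N y k s w = i),
        ‖pieceVec σ N y k a s w‖ ^ 2 := by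
  unfold cfam
  rw [tTransport_single_tpow (by norm_num : 0 < 2)]
  simp only [Finset.sum_apply]
  rw [trT_sum, Finset.sum_filter]
  refine Finset.sum_congr rfl fun w _ => ?_
  by_cases h : pieceCar σ N y k s w = i
  · rw [if_pos h, ← h, Pi.single_eq_same]
    simp only [trT, tpow, Fin.prod_univ_two, ← sq]
    exact sum_sq_eq_norm_sq _
  · rw [if_neg h, Pi.single_eq_of_ne (Ne.symm h)]
    simp [trT]

/-- The energies at a carrier are nonnegative. -/
theorem trT_cfam_nonneg (k : Fin (N + 1)) (a : V3) (s : ℕ) (i : Fin (N + 1)) :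
    0 ≤ trT (cfam σ N y k a s i) := by
  rw [trT_cfam]
  exact Finset.sum_nonneg fun _ _ => sq_nonneg _

/-! ## The children of the pieces and the decrement -/

/-- The cloud after `s + 1` steps as the sum over the pieces after `s` steps of their children. -/
theorem cloud_succ_eq_sum_children (hr : 0 < r) (s : ℕ) (k : Fin (N + 1)) (a : V3) :
    cloud r σ N y (s + 1) k a = ∑ w : Fin s → Bool, ∑ b : Bool,
      tpow r (childVec σ N y s (pieceCar σ N y k s w) (pieceVec σ N y k a s w) b) := by
  rw [cloud_eq_sum_pieces hr, ← Fintype.sum_equiv (Fin.snocEquiv fun _ => Bool)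
    (fun bw => tpow r (pieceVec σ N y k a (s + 1) (Fin.snocEquiv (fun _ => Bool) bw))) _
    (fun _ => rfl), Fintype.sum_prod_type, Finset.sum_comm]
  refine Finset.sum_congr rfl fun w _ => Finset.sum_congr rfl fun b _ => ?_
  simp [pieceVec, Fin.snocEquiv]

/-- The decrement is the sum over the pieces of their BRACKETS (power minus the powers of the two
children). -/
theorem dropT_eq_sum_brackets (s : ℕ) (k : Fin (N + 1)) (a : V3) :
    dropT σ N y k a s = ∑ w : Fin s → Bool,
      (tpow 2 (pieceVec σ N y k a s w) -
        ∑ b : Bool, tpow 2 (childVec σ N y s (pieceCar σ N y k s w) (pieceVec σ N y k a s w) b)) := by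
  unfold dropT
  rw [cloud_eq_sum_pieces (by norm_num : 0 < 2) s, cloud_succ_eq_sum_children (by norm_num : 0 < 2) s,
    ← Finset.sum_sub_distrib]

/-- `‖(u+v) ⊗ (u+v) − v ⊗ v − u ⊗ u‖² = 2 ‖u‖² ‖v‖²` for orthogonal `u, v`. -/
theorem normSqT_tpow_sub_split (u v : V3) (huv : ⟪u, v⟫_ℝ = 0) :
    normSqT (tpow 2 (u + v) - (tpow 2 v + tpow 2 u)) = 2 * ‖u‖ ^ 2 * ‖v‖ ^ 2 := by
  have hx : ∀ idx : Fin 2 → Fin 3, (tpow 2 (u + v) - (tpow 2 v + tpow 2 u)) idx =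
      u (idx 0) * v (idx 1) + v (idx 0) * u (idx 1) := by
    intro idx
    simp only [tpow, Pi.sub_apply, Pi.add_apply, Fin.prod_univ_two, PiLp.add_apply]
    ring
  simp only [normSqT, hx]
  rw [← Fintype.sum_equiv (finTwoArrowEquiv (Fin 3)).symm
    (fun ij => (u ij.1 * v ij.2 + v ij.1 * u ij.2) ^ 2) _ (fun _ => rfl), Fintype.sum_prod_type]
  have h1 : ∑ i : Fin 3, ∑ j : Fin 3, (u i * v j + v i * u j) ^ 2 =
      2 * (∑ i, u i ^ 2) * (∑ j, v j ^ 2) + 2 * (∑ i, u i * v i) ^ 2 := by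
    simp only [Fin.sum_univ_three]
    ring
  rw [h1, sum_sq_eq_norm_sq, sum_sq_eq_norm_sq, ← inner_eq_sum, huv]
  ring

/-- `Q m ⊥ P m`. -/
theorem inner_coprojV_projV (n m : V3) : ⟪coprojV n m, projV n m⟫_ℝ = 0 := by
  have h0 := norm_sq_projV_add_coprojV n m
  have h1 : m = projV n m + coprojV n m := by simp [coprojV]
  have h2 : ‖m‖ ^ 2 = ‖projV n m‖ ^ 2 + 2 * ⟪projV n m, coprojV n m⟫_ℝ + ‖coprojV n m‖ ^ 2 := by
    conv_lhs => rw [h1]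
    exact norm_add_sq_real _ _
  rw [real_inner_comm]
  linarith

/-- The PAIR WEIGHT of a carrier `c` with a value `x` (`x` if `c` is reflected at the step with data
`o`, `0` otherwise) is nonnegative for `x ≥ 0`. -/
theorem pairWeight_nonneg (o : Option (Fin (N + 1) × Fin (N + 1))) (c : Fin (N + 1)) {x : ℝ}
    (hx : 0 ≤ x) : 0 ≤ o.elim 0 (fun pq => if c = pq.1 ∨ c = pq.2 then x else 0) := by
  cases o with
  | none => simp
  | some pq =>
    simp only [Option.elim_some]
    split_ifs
    · exact hx
    · exact le_rfl

/-- THE BRACKET OF A PIECE: on the reflected pair it has squared norm `2 ‖Qm‖² ‖Pm‖² ≤ ‖m‖⁴/2`, off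
it (and at an identity step) it vanishes: `2 ‖bracket‖² ≤ (pair weight of ‖m‖²)²`. -/
theorem two_mul_normSqT_bracket_le (s : ℕ) (c : Fin (N + 1)) (m : V3) :
    2 * normSqT (tpow 2 m - ∑ b : Bool, tpow 2 (childVec σ N y s c m b)) ≤
      ((stepPair σ N y s).elim 0 (fun pq => if c = pq.1 ∨ c = pq.2 then ‖m‖ ^ 2 else 0)) ^ 2 := by
  rw [Fintype.sum_bool]
  rcases hs : stepPair σ N y s with _ | ⟨p, q⟩
  · simp [childVec, hs, tpow_zero_vec (by norm_num : 0 < 2), normSqT]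
  · by_cases h' : c = p ∨ c = q
    · set n := stepNormal σ N y s
      have hsplit : tpow 2 m - (tpow 2 (childVec σ N y s c m true) + tpow 2 (childVec σ N y s c m false)) =
          tpow 2 (coprojV n m + projV n m) - (tpow 2 (projV n m) + tpow 2 (coprojV n m)) := by
        simp only [childVec, hs, if_pos h', if_true, Bool.false_eq_true, if_false]
        congr 2
        simp [coprojV]
      rw [hsplit, normSqT_tpow_sub_split _ _ (inner_coprojV_projV n m), Option.elim_some, if_pos h']
      have hE := norm_sq_projV_add_coprojV n m
      nlinarith [sq_nonneg (‖coprojV n m‖ ^ 2 - ‖projV n m‖ ^ 2), sq_nonneg ‖coprojV n m‖,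
        sq_nonneg ‖projV n m‖]
    · simp [childVec, hs, if_neg h', tpow_zero_vec (by norm_num : 0 < 2), normSqT]

/-- The pair weights of the energies of the pieces add up to the trace of the pair tensor. -/
theorem sum_pairWeight (s : ℕ) (k : Fin (N + 1)) (a : V3) :
    ∑ w : Fin s → Bool, (stepPair σ N y s).elim 0 (fun pq =>
      if pieceCar σ N y k s w = pq.1 ∨ pieceCar σ N y k s w = pq.2
        then ‖pieceVec σ N y k a s w‖ ^ 2 else 0) = trT (pairTens σ N y k a s) := by
  rcases hs : stepPair σ N y s with _ | ⟨p, q⟩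
  · simp [pairTens, hs, trT]
  · have hpq : p ≠ q := ne_of_lt (stepPair_fst_lt_snd hs)
    simp only [pairTens, hs, Option.elim_some]
    rw [show trT (cfam σ N y k a s p + cfam σ N y k a s q) =
        trT (cfam σ N y k a s p) + trT (cfam σ N y k a s q) by simp [trT, Finset.sum_add_distrib],
      trT_cfam, trT_cfam, Finset.sum_filter, Finset.sum_filter, ← Finset.sum_add_distrib]
    refine Finset.sum_congr rfl fun w _ => ?_
    by_cases h1 : pieceCar σ N y k s w = p
    · have h2 : pieceCar σ N y k s w ≠ q := by rw [h1]; exact hpq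
      rw [if_pos (Or.inl h1), if_pos h1, if_neg h2, add_zero]
    · by_cases h2 : pieceCar σ N y k s w = q
      · rw [if_pos (Or.inr h2), if_neg h1, if_pos h2, zero_add]
      · rw [if_neg (not_or.2 ⟨h1, h2⟩), if_neg h1, if_neg h2, add_zero]

/-- THE FLOOR OF ONE STEP: `‖X_s‖² ≤ ½ (tr S_s)²`. -/
theorem normSqT_dropT_le (s : ℕ) (k : Fin (N + 1)) (a : V3) :
    normSqT (dropT σ N y k a s) ≤ 1 / 2 * trT (pairTens σ N y k a s) ^ 2 := by
  rw [dropT_eq_sum_brackets]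
  refine (normSqT_sum_le _ _).trans ?_
  have hle : ∀ w : Fin s → Bool,
      Real.sqrt (normSqT (tpow 2 (pieceVec σ N y k a s w) - ∑ b : Bool,
        tpow 2 (childVec σ N y s (pieceCar σ N y k s w) (pieceVec σ N y k a s w) b))) ≤
        Real.sqrt (1 / 2) * (stepPair σ N y s).elim 0 (fun pq =>
          if pieceCar σ N y k s w = pq.1 ∨ pieceCar σ N y k s w = pq.2
            then ‖pieceVec σ N y k a s w‖ ^ 2 else 0) := by
    intro w
    have h2 := two_mul_normSqT_bracket_le (σ := σ) (y := y) s (pieceCar σ N y k s w)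
      (pieceVec σ N y k a s w)
    have hnn := pairWeight_nonneg (stepPair σ N y s) (pieceCar σ N y k s w)
      (sq_nonneg ‖pieceVec σ N y k a s w‖)
    rw [← Real.sqrt_sq hnn, ← Real.sqrt_mul (by norm_num : (0 : ℝ) ≤ 1 / 2)]
    exact Real.sqrt_le_sqrt (by linarith)
  calc (∑ w : Fin s → Bool, Real.sqrt (normSqT (tpow 2 (pieceVec σ N y k a s w) - ∑ b : Bool,
          tpow 2 (childVec σ N y s (pieceCar σ N y k s w) (pieceVec σ N y k a s w) b)))) ^ 2
        ≤ (∑ w : Fin s → Bool, Real.sqrt (1 / 2) * (stepPair σ N y s).elim 0 (fun pq =>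
            if pieceCar σ N y k s w = pq.1 ∨ pieceCar σ N y k s w = pq.2
              then ‖pieceVec σ N y k a s w‖ ^ 2 else 0)) ^ 2 :=
          pow_le_pow_left₀ (Finset.sum_nonneg fun _ _ => Real.sqrt_nonneg _)
            (Finset.sum_le_sum fun w _ => hle w) 2
    _ = 1 / 2 * trT (pairTens σ N y k a s) ^ 2 := by
          rw [← Finset.mul_sum, sum_pairWeight, mul_pow, Real.sq_sqrt (by norm_num : (0:ℝ) ≤ 1/2)]

/-- THE FLOOR OVER A STRETCH: `quadF ≤ ½ pairPartF`. -/
theorem quadF_le_half_pairPartF (m₁ m₂ : ℕ) :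
    quadF σ N y m₁ m₂ ≤ 1 / 2 * pairPartF σ N y m₁ m₂ := by
  unfold quadF pairPartF
  rw [mul_left_comm]
  refine mul_le_mul_of_nonneg_left ?_ (inv_nonneg.2 (Nat.cast_nonneg _))
  rw [Finset.mul_sum]
  refine Finset.sum_le_sum fun k _ => ?_
  rw [Finset.mul_sum]
  refine Finset.sum_le_sum fun p _ => ?_
  rw [Finset.mul_sum]
  refine Finset.sum_le_sum fun q _ => ?_
  rw [Finset.mul_sum]
  exact Finset.sum_le_sum fun s _ => normSqT_dropT_le s k (dirV p q)

/-! ## The rank-3 half from carrier participation -/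

/-- `‖cloud₃(k, u)‖² ≤ ‖u‖² Σ_w ‖piece_w‖⁴` (Cauchy–Schwarz). -/
theorem normSqT_cloud_three_le_sum_pow_four (s : ℕ) (k : Fin (N + 1)) (u : V3) :
    normSqT (cloud 3 σ N y s k u) ≤ ‖u‖ ^ 2 * ∑ w : Fin s → Bool, ‖pieceVec σ N y k u s w‖ ^ 4 := by
  rw [cloud_eq_sum_pieces (by norm_num : 0 < 3) s k u]
  refine (normSqT_sum_le _ _).trans ?_
  simp only [sqrt_normSqT_tpow]
  have hcs := Finset.sum_mul_sq_le_sq_mul_sq (Finset.univ : Finset (Fin s → Bool))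
    (fun w => ‖pieceVec σ N y k u s w‖) (fun w => ‖pieceVec σ N y k u s w‖ ^ 2)
  have hE := pieces_energy (σ := σ) (y := y) k u s
  calc (∑ w : Fin s → Bool, ‖pieceVec σ N y k u s w‖ ^ 3) ^ 2
        = (∑ w : Fin s → Bool, ‖pieceVec σ N y k u s w‖ * ‖pieceVec σ N y k u s w‖ ^ 2) ^ 2 := by
          congr 1
          exact Finset.sum_congr rfl fun w _ => by ring
    _ ≤ (∑ w : Fin s → Bool, ‖pieceVec σ N y k u s w‖ ^ 2) *
          ∑ w : Fin s → Bool, (‖pieceVec σ N y k u s w‖ ^ 2) ^ 2 := hcs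
    _ = ‖u‖ ^ 2 * ∑ w : Fin s → Bool, ‖pieceVec σ N y k u s w‖ ^ 4 := by
          rw [hE]
          congr 1
          exact Finset.sum_congr rfl fun w _ => by ring

/-- Grouping the pieces by carrier: `Σ_w ‖piece_w‖⁴ ≤ Σ_i (tr T_i)²`. -/
theorem sum_pow_four_le_sum_trT_sq (s : ℕ) (k : Fin (N + 1)) (u : V3) :
    ∑ w : Fin s → Bool, ‖pieceVec σ N y k u s w‖ ^ 4 ≤
      ∑ i : Fin (N + 1), trT (cfam σ N y k u s i) ^ 2 := by
  rw [← Finset.sum_fiberwise Finset.univ (fun w : Fin s → Bool => pieceCar σ N y k s w)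
    (fun w => ‖pieceVec σ N y k u s w‖ ^ 4)]
  refine Finset.sum_le_sum fun i _ => ?_
  rw [trT_cfam]
  calc ∑ w ∈ Finset.univ.filter (fun w : Fin s → Bool => pieceCar σ N y k s w = i),
          ‖pieceVec σ N y k u s w‖ ^ 4
        = ∑ w ∈ Finset.univ.filter (fun w : Fin s → Bool => pieceCar σ N y k s w = i),
            (‖pieceVec σ N y k u s w‖ ^ 2) ^ 2 := Finset.sum_congr rfl fun w _ => by ring
    _ ≤ (∑ w ∈ Finset.univ.filter (fun w : Fin s → Bool => pieceCar σ N y k s w = i),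
            ‖pieceVec σ N y k u s w‖ ^ 2) ^ 2 :=
          Finset.sum_sq_le_sq_sum_of_nonneg fun _ _ => sq_nonneg _

/-- `‖cloud₃(k, u)‖² ≤ ‖u‖² Σ_i (tr T_i)²`: the cubic cloud is slaved to the carrier participation of
the rank-2 cloud of the same impulse. -/
theorem normSqT_cloud_three_le_carrPart (s : ℕ) (k : Fin (N + 1)) (u : V3) :
    normSqT (cloud 3 σ N y s k u) ≤ ‖u‖ ^ 2 * ∑ i : Fin (N + 1), trT (cfam σ N y k u s i) ^ 2 :=
  (normSqT_cloud_three_le_sum_pow_four s k u).trans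
    (mul_le_mul_of_nonneg_left (sum_pow_four_le_sum_trT_sq s k u) (sq_nonneg _))

/-- The cubic probes have squared length at most `3`. -/
theorem norm_sq_udir_le (p : Fin 10) : ‖udir p‖ ^ 2 ≤ 3 := by
  have h0 : ∀ v : V3, ‖v‖ ^ 2 = v 0 ^ 2 + v 1 ^ 2 + v 2 ^ 2 := fun v => by
    rw [EuclideanSpace.real_norm_sq_eq, Fin.sum_univ_three]
  fin_cases p <;> simp [h0, udir, baseV] <;> norm_num

/-- THE RANK-3 HALF, PATHWISE: `cd3x ≤ 3 · carrPartF` at the window's step count (registered anchor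
of this helper file). -/
theorem cd3x_le_carrPartF : ∀ (σ : ℝ) (N : ℕ) (y : Cfg N) (Δ : ℝ),
    cd3x σ N y Δ ≤ 3 * carrPartF σ N y (steps σ N y Δ) := by
  intro σ N y Δ
  unfold cd3x carrPartF
  set m := steps σ N y Δ
  rw [mul_left_comm]
  refine mul_le_mul_of_nonneg_left ?_ (inv_nonneg.2 (Nat.cast_nonneg _))
  rw [Finset.mul_sum]
  refine Finset.sum_le_sum fun k _ => ?_
  have hA : 0 ≤ ∑ p : Fin 3, ∑ q : Fin 3, ∑ i : Fin (N + 1), trT (cfam σ N y k (dirV p q) m i) ^ 2 :=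
    Finset.sum_nonneg fun _ _ => Finset.sum_nonneg fun _ _ => Finset.sum_nonneg fun _ _ => sq_nonneg _
  have hB : ∑ p : Fin 10, normSqT (cloud 3 σ N y m k (udir p)) ≤
      3 * ∑ p : Fin 10, ∑ i : Fin (N + 1), trT (cfam σ N y k (udir p) m i) ^ 2 := by
    rw [Finset.mul_sum]
    refine Finset.sum_le_sum fun p _ => (normSqT_cloud_three_le_carrPart m k (udir p)).trans ?_
    exact mul_le_mul_of_nonneg_right (norm_sq_udir_le p)
      (Finset.sum_nonneg fun _ _ => sq_nonneg _)
  linarith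

/-! ## Signs -/

/-- The cloud-averaged anisotropy is nonnegative. -/
theorem anisF_nonneg (s : ℕ) : 0 ≤ anisF σ N y s :=
  mul_nonneg (inv_nonneg.2 (Nat.cast_nonneg _)) (Finset.sum_nonneg fun _ _ =>
    Finset.sum_nonneg fun _ _ => Finset.sum_nonneg fun _ _ => normSqT_nonneg _)

/-- The carrier participation is nonnegative. -/
theorem carrPartF_nonneg (s : ℕ) : 0 ≤ carrPartF σ N y s :=
  mul_nonneg (inv_nonneg.2 (Nat.cast_nonneg _)) (Finset.sum_nonneg fun _ _ => add_nonneg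
    (Finset.sum_nonneg fun _ _ => Finset.sum_nonneg fun _ _ => Finset.sum_nonneg fun _ _ => sq_nonneg _)
    (Finset.sum_nonneg fun _ _ => Finset.sum_nonneg fun _ _ => sq_nonneg _))

/-- The pair participation is nonnegative. -/
theorem pairPartF_nonneg (m₁ m₂ : ℕ) : 0 ≤ pairPartF σ N y m₁ m₂ :=
  mul_nonneg (inv_nonneg.2 (Nat.cast_nonneg _)) (Finset.sum_nonneg fun _ _ =>
    Finset.sum_nonneg fun _ _ => Finset.sum_nonneg fun _ _ => Finset.sum_nonneg fun _ _ => sq_nonneg _)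

/-- Hence `cd2 + cd3x ≤ anisF + 3 carrPartF` at the window's step count: the quantity integrated in
`CDAlongAt` is controlled by the balance functional and the carrier participation. -/
theorem cd2_add_cd3x_le (Δ : ℝ) :
    cd2 σ N y Δ + cd3x σ N y Δ ≤ anisF σ N y (steps σ N y Δ) + 3 * carrPartF σ N y (steps σ N y Δ) := by
  rw [cd2_eq_anisF]
  linarith [cd3x_le_carrPartF σ N y Δ]

end

end ColumnDepolarisation
end Summit.AtomisticToContinuum.HydrodynamicLimit.Theorems.ContactSourceDuhamel.TimeLocal
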